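import Summits.QuantumFields.YangMills.Theorems.UnitScaleTiltProp7SectET3Eq3124RowsT3
import HarnessLib

/-!
# Route `UnitScaleTilt` (α), node N06(d = 3), layer 0 ∕ brick L0f — **THE HILBERT-LEVEL INPUTS OF THE `Ops`-RECORD ROWS FOR THE LAYER-0 TOTAL LETTERS WITH THREE
# HESSIAN SLOTS**: the inverse rows `G₀Δ_a = 1`, `(Δ_a − Δ′_π)G = 1`, `(Δ_a − Δ′_π − Δ⁽²⁾_π)G₁ = 1`, the unfolding `𝔊 = G₁(1 − Q*(QG₁Q*)⁻¹QG₁ − DRD*G₁)`, `QG₁Q*(QG₁Q*)⁻¹ = 1`,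
# **the (3.124) triple `QG₁DR = 0`, `RD*G₁Q* = 0`, `RD*G₁DR = R` PROVED generically in the Hessian slot** from the slot's gauge invariance on `N_S(U₀)` and symmetry (the
# `B6Eq231` mechanism on brick L0c's rows), and the symmetries of `Δ_a`, `G`, the pairs `(D, D*)`, `(Q, Q*)`, `R` — i.e. EVERY Hilbert-level hypothesis of
# ✓ `Prop7SectET3OpsOfConjugateReading.identities_of_conjugateReading` ∕ `letterSymm_of_conjugateReading` ∕ `posDefEnd_S0_of_conjugateReading` at ym-inputs-p01's letters, ON THE CLASS

Cell `ym-inputs` (D-0154 (2); desk `ym-inputs-plan-1` INPUT-LIST v7 §4 row p05 = I-06 (d) «structural rows for `𝔬_T3`»; desk answer 2026-08-28T09:25:14Z «p01 names∕types the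
DEF-ONLY `def 𝔬_T3`, p05 the def-free rows»; p05 g1's memo `pub/ym-inputs/L0F-LOCATE-p05.md` §2 (c) «Hessian slots» + §3 (i)–(iii)), seat ym-inputs-p05 g2.  Count-neutral helper
(`--supports stmt-QuantumFields-20520 --as helper`; RULING g26-№2); registry untouched; THEOREMS ONLY (0 `def`, 0 `sorry`); NOTHING of [Balaban1985BackgroundPropagators] is asserted.

THE DICTIONARY (memo §2 (c); ym-inputs-p01's DEFINER-MEMO-T3 §2 L0f).  Track A's letter record `B9Thm312Whole.Ops` reads, at a T³ member and a background `U₀`, print's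
`G₀ = (Δ + DRD* + Q*aQ)⁻¹`, `Δ_a = G₀⁻¹`, `Δ′_π = Δ − Δ_π` ((3.120)), `Δ⁽²⁾_π = Δ_π − Δ₁` ((3.134)∕(3.138)), `G = (Δ_π + …)⁻¹` ((3.122)), `G₁ = (Δ₁ + …)⁻¹` ((3.128)),
`(QGQ*)⁻¹`, `(QG₁Q*)⁻¹`, `H` ((3.126)), `H₁` ((3.129)), `𝔊 = G₁𝔓*` ((3.153)), `Q`, `Q*`, the `D`, `D*`, `R` of `DRD*`.  With ym-inputs-p01's TOTAL letters of
✓ `Prop7SectET3CurvedPropagators` (generic in a Hessian letter `Δx`) and THREE SLOTS `Δ0x` (print's `Δ` = ✓ `Prop7SectET3WilsonHessian.DeltaEtaSlot`), `Δπx` (`Δ_π` =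
✓ `Prop7SectET3DeltaPi.DeltaPiSlot`), `Δ1x` (`Δ₁` of (3.128)∕[Balaban1985Variational] (110), a later brick), the dictionary is: `G0 := GT Δ0x`, `S0 := laplaceA Δ0x`, `Tpi := Δ0x − Δπx`,
`T2 := Δπx − Δ1x`, `G := GT Δπx`, `C := KinvT Δπx`, `Hm := HT Δπx`, `G1 := GT Δ1x`, `C1 := KinvT Δ1x`, `H1m := HT Δ1x`, `GG := frakGT Δ1x`, `Q := Qk`, `Qstar := Qk†`, `Dv := DL2`,
`Dvstar := DstarL2`, `R := RS` — and brick L0f's `𝔬_T3` is their coordinate-conjugate reading (✓ `Prop7SectET3OpsOfConjugateReading`).  THIS FILE proves, at the Hilbert level and ON THE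
CLASS `PosOnto` (= [B9] Thm 3.11's positivity + `Q` onto, an N06 INPUT on the regular class, DISPLAYED), every identity ∕ symmetry that reading consumes.

WHAT IS PROVED (ns `…Theorems.Prop7SectET3OpsT3HilbertRows`; member `F`, `h : n ≤ K`, parameters `c₀ cB a`):
* §1 SLOT ALGEBRA AND INVERSES: `laplaceA_sub_laplaceA` (`Δ_a` is the slot plus slot-free terms: `Δ_a[Δ0x] − Δ_a[Δπx] = Δ0x − Δπx`), `laplaceA_sub_slot_sub`, `laplaceA_sub_slot_sub_add`
  (`Δ_a − Δ′_π = Δ_a[Δπx]`, `Δ_a − (Δ′_π + Δ⁽²⁾_π) = Δ_a[Δ1x]`); ★`GT_comp_laplaceA` (`G ∘ Δ_a = id`, the LEFT inverse `invG0'` wants — ym-inputs-p01's ✓`GT_laplaceA` as a map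
  equality), `laplaceA_comp_GT`; ★`invG_row`, ★`invG1_row` (F7's `invG`∕`invG1` verbatim); ★`c1_inv_row` (`QG₁Q*(QG₁Q*)⁻¹ = 1`); `frakGT_eq` (`𝔊 = G₁ ∘ (1 − Q†C₁QG₁ − DRD*G₁)`, F7's `eq153`, by
  `rfl`).  (`eq126`∕`eq129` ARE ✓ `HT_eq_comp` — cited, not restated.)
* §2 THE (3.124) TRIPLE AS MAP EQUALITIES, GENERIC IN THE SLOT `Δx`, from `hΔ : ∀ λ ∈ N_S(U₀), Δx(U₀)(D_{U₀}λ) = 0` (the Hessian letter kills the residual pure-gauge modes — print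
  p. 419) and, for the second member, `hΔs : (Δx U₀).IsSymmetric`: ★`h124Q_row` (`Q ∘ G ∘ D ∘ R_S = 0` ⇐ ym-inputs-p01's ✓`Qk_GT_DL2_RS`, L0e-2), ★`hR_row` (`R_S ∘ D* ∘ G ∘ D ∘ R_S = R_S` ⇐
  ✓`RS_DstarL2_GT_DL2_RS`), `laplaceA_isSymmetric`, ★`GT_isSymmetric` (`G` symmetric from `Δ_a` symmetric and the two-sided inverse), ★★`RS_DstarL2_GT_adjoint_Qk`∕`h124R_row` — **(3.124)₁
  `R_S D* G Q† = 0`, NEW** (the adjoint of (3.124)₂: `⟨R_S D* G Q† y, t⟩ = ⟨y, Q G D R_S t⟩ = 0`; p01's 09:53:40Z «STILL OPEN: (3.124)₁ ⇐ self-adjointness» — here modulo the displayed `hΔs`).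
* §3 THE LETTER SYMMETRIES ∕ ADJOINT PAIRS print uses tacitly (p. 391): `sub_slot_isSymmetric` (`Δ′_π`, `Δ⁽²⁾_π`), `inner_Qk_left` (`⟨Qu, b⟩ = ⟨u, Q†b⟩`), `inner_DL2_left`
  (`⟨Dλ, f⟩ = ⟨λ, D*f⟩`, ✓ `adjoint_DL2`), `inner_RS_left` (`R` symmetric); positivity `0 < re⟨x, Δ_a x⟩` IS the field `PosOnto.pos` (not restated).
HONEST SCOPE: finite-dimensional Hilbert-space algebra about ym-inputs-p01's definitions; positivity ∕ onto-ness NOT proved (the class); whether `DeltaPiSlot`∕`Δ₁` satisfy `hΔ` is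
brick L0b∕L0e's row (p01), displayed here; no estimate; N06(d = 3) NOT discharged; nothing here claims EX, the crux, d = 4 or the mass gap; YM₃ on T³ is ladder rung R3, not Clay.

References: T. Bałaban, CMP **99** (1985) 389–434 [Balaban1985BackgroundPropagators] (p.391; (3.21)–(3.27) pp.394–395; (3.115) p.418; (3.119)–(3.130) pp.419–421; (3.124) p.420;
(3.147) p.425; (3.153) p.426; Thm 3.11 p.416); CMP **102** (1985) 277–309 [Balaban1985Variational] ((110)–(111) p.294).
-/

set_option autoImplicit false

noncomputable section

open scoped InnerProductSpace ComplexConjugate Matrix.Norms.L2Operator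

namespace Summit.QuantumFields.YangMills.Theorems.Prop7SectET3OpsT3HilbertRows

open Literature.MathematicalPhysics.QuantumFieldTheory.Balaban1983to89
open Literature.MathematicalPhysics.QuantumFieldTheory.Balaban1983to89.T3ContinuumYM3Torus
open T3SectALandauChart (eta eta_pos)
open B9Eq311L2Pairing (WL2)
open B11Eq111FrakG (frakGLin frakPstarLin)
open B11Eq103H1Complex (SiteL2K BondL2K laplaceAK laplaceAK_apply laplaceALatticeK G1LatticeK G1K_laplaceAK laplaceALatticeK_isSymmetric)
open Summit.QuantumFields.YangMills.Theorems.Prop7SectET3Transport (periodsT3)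
open Summit.QuantumFields.YangMills.Theorems.Prop7SectET3HilbertLetters (W₂ adBg adBgInv adBg_pair QL2 DL2 DstarL2 covLapSite adjoint_DL2)
open Summit.QuantumFields.YangMills.Theorems.Prop7SectET3GaugeProjector (RS NS QDS RS_isSymmetric exists_mem_NS_RS_eq RS_apply_covLapSite_of_mem QL2_DL2_eq_zero_of_mem_NS)
open Summit.QuantumFields.YangMills.Theorems.Prop7SectET3CurvedPropagators (Qk laplaceA PosOnto GT KinvT HT frakPT frakGT GT_of_pos KinvT_of_pos HT_of_pos HT_eq_comp laplaceA_GT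
  Qk_GT_adjoint_KinvT Qk_HT GT_laplaceA laplaceA_DL2_of_mem_NS GT_DL2_RS Qk_GT_DL2_RS RS_DstarL2_GT_DL2_RS)

variable {F : T3Family} {n K : ℕ} {h : n ≤ K} {c₀ cB a : ℝ} [Fact (0 < c₀)] [Fact (0 < cB)]
  {Δx Δ0x Δπx Δ1x : GaugeField (F.P K) 0 (Matrix.specialUnitaryGroup (Fin 2) ℂ) → (BondL2K ℂ 3 (periodsT3 F K) c₀ W₂ →ₗ[ℂ] BondL2K ℂ 3 (periodsT3 F K) c₀ W₂)}

/-! ## §1 The slot algebra of `Δ_a` and the inverse rows `invG0'`, `invG`, `invG1`, `c1_inv`, `eq153` -/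

/-- **`Δ_a` IS THE SLOT PLUS SLOT-FREE TERMS**: `Δ_a[Δ0x](U₀) − Δ_a[Δπx](U₀) = Δ0x(U₀) − Δπx(U₀)` (the `DRD*` and `Q*aQ` terms of (3.26) do not see the Hessian letter).
[cite: Balaban1985BackgroundPropagators, (3.26) p.395, (3.120)–(3.122) pp.419–420] -/
theorem laplaceA_sub_laplaceA (U₀ : GaugeField (F.P K) 0 (Matrix.specialUnitaryGroup (Fin 2) ℂ)) :
    laplaceA F n K h c₀ cB a Δ0x U₀ - laplaceA F n K h c₀ cB a Δπx U₀ = Δ0x U₀ - Δπx U₀ := by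
  unfold laplaceA laplaceALatticeK laplaceAK
  abel

/-- **(3.120)∕(3.122): `Δ_a − Δ′_π = Δ_π + DRD* + Q*aQ`** with `Δ′_π := Δ − Δ_π` — in slots: `Δ_a[Δ0x] − (Δ0x − Δπx) = Δ_a[Δπx]`.
[cite: Balaban1985BackgroundPropagators, (3.120)–(3.122) pp.419–420] -/
theorem laplaceA_sub_slot_sub (U₀ : GaugeField (F.P K) 0 (Matrix.specialUnitaryGroup (Fin 2) ℂ)) :
    laplaceA F n K h c₀ cB a Δ0x U₀ - (Δ0x U₀ - Δπx U₀) = laplaceA F n K h c₀ cB a Δπx U₀ := by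
  rw [← laplaceA_sub_laplaceA (h := h) (cB := cB) (a := a) U₀, sub_sub_cancel]

/-- **(3.128)∕(3.134): `Δ_a − (Δ′_π + Δ⁽²⁾_π) = Δ₁ + DRD* + Q*aQ`** with `Δ⁽²⁾_π := Δ_π − Δ₁` — in slots: `Δ_a[Δ0x] − ((Δ0x − Δπx) + (Δπx − Δ1x)) = Δ_a[Δ1x]`.
[cite: Balaban1985BackgroundPropagators, (3.128) p.421, (3.134)–(3.138) pp.422–423] -/
theorem laplaceA_sub_slot_sub_add (U₀ : GaugeField (F.P K) 0 (Matrix.specialUnitaryGroup (Fin 2) ℂ)) :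
    laplaceA F n K h c₀ cB a Δ0x U₀ - ((Δ0x U₀ - Δπx U₀) + (Δπx U₀ - Δ1x U₀)) = laplaceA F n K h c₀ cB a Δ1x U₀ := by
  rw [sub_add_sub_cancel, ← laplaceA_sub_laplaceA (h := h) (cB := cB) (a := a) U₀, sub_sub_cancel]

/-- ★ **`G ∘ Δ_a = id` ON THE CLASS** — F7's `invG0'` (`G₀Δ_a = 1`, p. 421) at the slot `Δ0x`, and the same row at every slot. [cite: Balaban1985BackgroundPropagators, (3.27) p.395, p.421] -/
theorem GT_comp_laplaceA {U₀ : GaugeField (F.P K) 0 (Matrix.specialUnitaryGroup (Fin 2) ℂ)} (hp : PosOnto F n K h c₀ cB a Δx U₀) :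
    GT F n K h c₀ cB a Δx U₀ ∘ₗ laplaceA F n K h c₀ cB a Δx U₀ = LinearMap.id :=
  LinearMap.ext (GT_laplaceA hp)

/-- **`Δ_a ∘ G = id` ON THE CLASS** (the right inverse, ✓ `laplaceA_GT` as a map equality). [cite: Balaban1985BackgroundPropagators, (3.27) p.395] -/
theorem laplaceA_comp_GT {U₀ : GaugeField (F.P K) 0 (Matrix.specialUnitaryGroup (Fin 2) ℂ)} (hp : PosOnto F n K h c₀ cB a Δx U₀) :
    laplaceA F n K h c₀ cB a Δx U₀ ∘ₗ GT F n K h c₀ cB a Δx U₀ = LinearMap.id :=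
  LinearMap.ext (laplaceA_GT hp)

/-- ★ **F7's `invG` AT THE HILBERT LEVEL: `(Δ_a − Δ′_π) ∘ G = id` ON THE CLASS of the slot `Δπx`** ((3.120)+(3.122): `G⁻¹ = Δ_a − Δ′_π`).
[cite: Balaban1985BackgroundPropagators, (3.120)–(3.122) pp.419–420] -/
theorem invG_row {U₀ : GaugeField (F.P K) 0 (Matrix.specialUnitaryGroup (Fin 2) ℂ)} (hp : PosOnto F n K h c₀ cB a Δπx U₀) :
    (laplaceA F n K h c₀ cB a Δ0x U₀ - (Δ0x U₀ - Δπx U₀)) ∘ₗ GT F n K h c₀ cB a Δπx U₀ = LinearMap.id := by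
  rw [laplaceA_sub_slot_sub]
  exact laplaceA_comp_GT hp

/-- ★ **F7's `invG1` AT THE HILBERT LEVEL: `(Δ_a − (Δ′_π + Δ⁽²⁾_π)) ∘ G₁ = id` ON THE CLASS of the slot `Δ1x`** ((3.128), (3.134)).
[cite: Balaban1985BackgroundPropagators, (3.128) p.421, (3.134) p.422] -/
theorem invG1_row {U₀ : GaugeField (F.P K) 0 (Matrix.specialUnitaryGroup (Fin 2) ℂ)} (hp : PosOnto F n K h c₀ cB a Δ1x U₀) :
    (laplaceA F n K h c₀ cB a Δ0x U₀ - ((Δ0x U₀ - Δπx U₀) + (Δπx U₀ - Δ1x U₀))) ∘ₗ GT F n K h c₀ cB a Δ1x U₀ = LinearMap.id := by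
  rw [laplaceA_sub_slot_sub_add]
  exact laplaceA_comp_GT hp

/-- ★ **F7's `c1_inv` AT THE HILBERT LEVEL: `Q ∘ G ∘ Q† ∘ (QGQ*)⁻¹ = id` ON THE CLASS** (✓ `Qk_GT_adjoint_KinvT` as a map equality). [cite: Balaban1985BackgroundPropagators, (3.126) p.420; Balaban1985Variational, (45) p.285] -/
theorem c1_inv_row {U₀ : GaugeField (F.P K) 0 (Matrix.specialUnitaryGroup (Fin 2) ℂ)} (hp : PosOnto F n K h c₀ cB a Δx U₀) :
    Qk F n K h c₀ cB U₀ ∘ₗ GT F n K h c₀ cB a Δx U₀ ∘ₗ LinearMap.adjoint (Qk F n K h c₀ cB U₀) ∘ₗ KinvT F n K h c₀ cB a Δx U₀ = LinearMap.id :=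
  LinearMap.ext (Qk_GT_adjoint_KinvT hp)

/-- **F7's `eq153` AT THE HILBERT LEVEL, HYPOTHESIS-FREE: `𝔊 = G ∘ (1 − Q†(QGQ*)⁻¹QG − DRD*G)`** (lit-balaban's `frakGLin`∕`frakPstarLin` unfolded at the total letters; `R := R_S`).
[cite: Balaban1985BackgroundPropagators, (3.153) p.426; Balaban1985Variational, (110)–(111) p.294] -/
theorem frakGT_eq (U₀ : GaugeField (F.P K) 0 (Matrix.specialUnitaryGroup (Fin 2) ℂ)) :
    frakGT F n K h c₀ cB a Δx U₀ =
      GT F n K h c₀ cB a Δx U₀ ∘ₗ (LinearMap.id - LinearMap.adjoint (Qk F n K h c₀ cB U₀) ∘ₗ KinvT F n K h c₀ cB a Δx U₀ ∘ₗ Qk F n K h c₀ cB U₀ ∘ₗ GT F n K h c₀ cB a Δx U₀ -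
        DL2 F n K c₀ U₀ ∘ₗ RS F n K h c₀ cB U₀ ∘ₗ DstarL2 F n K c₀ U₀ ∘ₗ GT F n K h c₀ cB a Δx U₀) := rfl

/-! ## §2 The (3.124) triple `QG₁DR = 0`, `RD*G₁Q* = 0`, `RD*G₁DR = R`, generic in the slot -/

/-- ★★ **F7's `h124Q` AT THE HILBERT LEVEL: `Q ∘ G ∘ D ∘ R_S = 0` ON THE CLASS.** [cite: Balaban1985BackgroundPropagators, (3.124) p.420] -/
theorem h124Q_row {U₀ : GaugeField (F.P K) 0 (Matrix.specialUnitaryGroup (Fin 2) ℂ)} (hp : PosOnto F n K h c₀ cB a Δx U₀)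
    (hΔ : ∀ l ∈ NS F n K h c₀ cB U₀, Δx U₀ (DL2 F n K c₀ U₀ l) = 0) :
    Qk F n K h c₀ cB U₀ ∘ₗ GT F n K h c₀ cB a Δx U₀ ∘ₗ DL2 F n K c₀ U₀ ∘ₗ RS F n K h c₀ cB U₀ = 0 :=
  LinearMap.ext (Qk_GT_DL2_RS hp hΔ)

/-- ★★ **F7's `hR` AT THE HILBERT LEVEL: `R_S ∘ D* ∘ G ∘ D ∘ R_S = R_S` ON THE CLASS.** [cite: Balaban1985BackgroundPropagators, (3.124) p.420, (3.147) p.425] -/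
theorem hR_row {U₀ : GaugeField (F.P K) 0 (Matrix.specialUnitaryGroup (Fin 2) ℂ)} (hp : PosOnto F n K h c₀ cB a Δx U₀)
    (hΔ : ∀ l ∈ NS F n K h c₀ cB U₀, Δx U₀ (DL2 F n K c₀ U₀ l) = 0) :
    RS F n K h c₀ cB U₀ ∘ₗ DstarL2 F n K c₀ U₀ ∘ₗ GT F n K h c₀ cB a Δx U₀ ∘ₗ DL2 F n K c₀ U₀ ∘ₗ RS F n K h c₀ cB U₀ = RS F n K h c₀ cB U₀ :=
  LinearMap.ext (RS_DstarL2_GT_DL2_RS hp hΔ)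

/-- **`Δ_a(U₀)` IS SYMMETRIC when the Hessian letter is** ([B11] p. 293's «scalar product defined by Δ₁ + D*RD + aQ*Q»; lit-balaban's `laplaceALatticeK_isSymmetric` with the unitary
transporter pair ✓ `adBg_pair` and ✓ `RS_isSymmetric`). [cite: Balaban1985Variational, p.293; Balaban1985BackgroundPropagators, (3.26) p.395] -/
theorem laplaceA_isSymmetric {U₀ : GaugeField (F.P K) 0 (Matrix.specialUnitaryGroup (Fin 2) ℂ)} (hΔs : (Δx U₀).IsSymmetric) :
    (laplaceA F n K h c₀ cB a Δx U₀).IsSymmetric :=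
  laplaceALatticeK_isSymmetric (by rw [← Complex.ofReal_inv, Complex.conj_ofReal]) (adBg_pair U₀) hΔs (RS_isSymmetric U₀)

/-- ★ **`G(U₀)` IS SYMMETRIC ON THE CLASS** when the Hessian letter is: `⟨Gx, y⟩ = ⟨Gx, Δ_a Gy⟩ = ⟨Δ_a Gx, Gy⟩ = ⟨x, Gy⟩` (print: «adjoint … with respect to natural L² scalar products»,
p. 391; the propagators are self-adjoint). [cite: Balaban1985BackgroundPropagators, p.391, (3.27) p.395] -/
theorem GT_isSymmetric {U₀ : GaugeField (F.P K) 0 (Matrix.specialUnitaryGroup (Fin 2) ℂ)} (hp : PosOnto F n K h c₀ cB a Δx U₀) (hΔs : (Δx U₀).IsSymmetric) :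
    (GT F n K h c₀ cB a Δx U₀).IsSymmetric := by
  intro x y
  have hs := laplaceA_isSymmetric (h := h) (cB := cB) (a := a) hΔs
  conv_lhs => rw [← laplaceA_GT hp y]
  rw [← hs, laplaceA_GT hp x]

/-- ★★ **(3.124), SECOND MEMBER, POINTWISE: `R_S D* G Q† y = 0`** ON THE CLASS when the Hessian letter is symmetric — the adjoint of the first member: for every `t`,
`⟨R_S D* G Q† y, t⟩ = ⟨y, Q G D R_S t⟩ = 0` (`R_S` symmetric, `D* = D†`, `G` symmetric, `Q†` the adjoint). [cite: Balaban1985BackgroundPropagators, (3.124) p.420] -/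
theorem RS_DstarL2_GT_adjoint_Qk {U₀ : GaugeField (F.P K) 0 (Matrix.specialUnitaryGroup (Fin 2) ℂ)} (hp : PosOnto F n K h c₀ cB a Δx U₀) (hΔs : (Δx U₀).IsSymmetric)
    (hΔ : ∀ l ∈ NS F n K h c₀ cB U₀, Δx U₀ (DL2 F n K c₀ U₀ l) = 0) (y : WL2 ℂ (fun _ : PBond (F.P n) 0 => cB) W₂) :
    RS F n K h c₀ cB U₀ (DstarL2 F n K c₀ U₀ (GT F n K h c₀ cB a Δx U₀ (LinearMap.adjoint (Qk F n K h c₀ cB U₀) y))) = 0 := by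
  refine ext_inner_right ℂ fun t => ?_
  rw [inner_zero_left, RS_isSymmetric U₀, ← adjoint_DL2, LinearMap.adjoint_inner_left, GT_isSymmetric hp hΔs, LinearMap.adjoint_inner_left, Qk_GT_DL2_RS hp hΔ,
    inner_zero_right]

/-- ★★ **F7's `h124R` AT THE HILBERT LEVEL: `R_S ∘ D* ∘ G ∘ Q† = 0` ON THE CLASS** (Hessian letter symmetric and killing `D_{U₀}N_S`). [cite: Balaban1985BackgroundPropagators, (3.124) p.420] -/
theorem h124R_row {U₀ : GaugeField (F.P K) 0 (Matrix.specialUnitaryGroup (Fin 2) ℂ)} (hp : PosOnto F n K h c₀ cB a Δx U₀) (hΔs : (Δx U₀).IsSymmetric)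
    (hΔ : ∀ l ∈ NS F n K h c₀ cB U₀, Δx U₀ (DL2 F n K c₀ U₀ l) = 0) :
    RS F n K h c₀ cB U₀ ∘ₗ DstarL2 F n K c₀ U₀ ∘ₗ GT F n K h c₀ cB a Δx U₀ ∘ₗ LinearMap.adjoint (Qk F n K h c₀ cB U₀) = 0 :=
  LinearMap.ext (RS_DstarL2_GT_adjoint_Qk hp hΔs hΔ)

/-! ## §3 The letter symmetries and adjoint pairs print uses tacitly (p. 391) -/

omit [Fact (0 < cB)] in
/-- **`Δ′_π = Δ − Δ_π` AND `Δ⁽²⁾_π = Δ_π − Δ₁` ARE SYMMETRIC when the slots are** (the `Tpi`∕`T2` members of the letter-symmetry row `hls`). [cite: Balaban1985BackgroundPropagators, (3.120) p.419, (3.134) p.422] -/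
theorem sub_slot_isSymmetric {U₀ : GaugeField (F.P K) 0 (Matrix.specialUnitaryGroup (Fin 2) ℂ)} (h₁ : (Δ0x U₀).IsSymmetric) (h₂ : (Δπx U₀).IsSymmetric) :
    (Δ0x U₀ - Δπx U₀).IsSymmetric :=
  h₁.sub h₂

/-- **`Q*` IS THE ADJOINT OF `Q`** (F7's `adjQ` at the Hilbert level): `⟨Q_k u, b⟩ = ⟨u, Q_k† b⟩`. [cite: Balaban1985BackgroundPropagators, p.391, (3.16) p.393] -/
theorem inner_Qk_left (U₀ : GaugeField (F.P K) 0 (Matrix.specialUnitaryGroup (Fin 2) ℂ)) (u : BondL2K ℂ 3 (periodsT3 F K) c₀ W₂) (b : WL2 ℂ (fun _ : PBond (F.P n) 0 => cB) W₂) :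
    ⟪Qk F n K h c₀ cB U₀ u, b⟫_ℂ = ⟪u, LinearMap.adjoint (Qk F n K h c₀ cB U₀) b⟫_ℂ :=
  (LinearMap.adjoint_inner_right _ u b).symm

omit [Fact (0 < cB)] in
/-- **`D*` IS THE ADJOINT OF `D` IN `DRD*`** (F7's `adjDv` at the Hilbert level): `⟨D_{U₀}λ, f⟩ = ⟨λ, D*_{U₀}f⟩` (✓ `adjoint_DL2`). [cite: Balaban1985BackgroundPropagators, (3.8) p.392] -/
theorem inner_DL2_left (U₀ : GaugeField (F.P K) 0 (Matrix.specialUnitaryGroup (Fin 2) ℂ)) (l : SiteL2K ℂ 3 (periodsT3 F K) c₀ W₂) (f : BondL2K ℂ 3 (periodsT3 F K) c₀ W₂) :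
    ⟪DL2 F n K c₀ U₀ l, f⟫_ℂ = ⟪l, DstarL2 F n K c₀ U₀ f⟫_ℂ := by
  rw [← adjoint_DL2, LinearMap.adjoint_inner_right]

omit [Fact (0 < cB)] in
/-- **`R_S` IS SYMMETRIC** (F7's `symmR` at the Hilbert level): `⟨R_S s, t⟩ = ⟨s, R_S t⟩` (✓ `RS_isSymmetric`). [cite: Balaban1985BackgroundPropagators, (3.21) p.394] -/
theorem inner_RS_left (U₀ : GaugeField (F.P K) 0 (Matrix.specialUnitaryGroup (Fin 2) ℂ)) (s t : SiteL2K ℂ 3 (periodsT3 F K) c₀ W₂) :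
    ⟪RS F n K h c₀ cB U₀ s, t⟫_ℂ = ⟪s, RS F n K h c₀ cB U₀ t⟫_ℂ :=
  RS_isSymmetric U₀ s t

end Summit.QuantumFields.YangMills.Theorems.Prop7SectET3OpsT3HilbertRows

end
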